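import Literature.NumberTheory.LFunctions.Zhang2022.KnifeEdgeEllVernierForm

/-!
# §D edge ell — card `ell-vernier-far-pair`: desk bookkeeping — every (A)-guarded shape of the vernier layer is
# implied by «¬(A) eventually» (the tribunal's T1 «not ≥ S» reading, kernel form)

Y. Zhang, *Discrete mean estimates and the Landau–Siegel zero*, arXiv:2211.02515v1 [Zhang2022LandauSiegel] — an
unrefereed manuscript under adjudication. **WHAT THIS IS NOT: not a claim about Theorems 1–2 of arXiv:2211.02515, about
Landau–Siegel zeros, about Parity, or about a repaired `Margin232`. The programme SEARCHES and TYPES; no claim about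
Landau–Siegel zeros, Theorems 1–2 of arXiv:2211.02515 or a repaired Margin232 until a kernel theorem says so.**
(LANDAU–SIEGEL programme F-S3, cell `landau-siegel`, §D edge ell; typer ls-knife-typer-2 g3. Tribunal desk T1 pre-readings
frontier-trib-ls-2 2026-08-26T23:58:04Z (1), 2026-08-27T00:49:01Z (E1–E3), 01:30:01Z: «every non-numeric crux is
(A)-guarded … hence implied by ¬(A)-eventually … T1 = not-shown … jointly sandwiched between ¬(A)-eventually and Theorem1»;
desk probe files `VernierProbe.lean` ad3e84dc8b90b685 / `VernierEndgameProbe.lean` 524eb772a83cd05a — restated here as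
tree lemmas so route packets and verdicts can cite them by name.)

Content (theorems only; «¬(A) eventually» = `ForAllLarge fun D _ χ => ¬ AssumptionA D χ`, no named Prop introduced) — (1) each OPEN shape of the layer follows
from it: `vernierPositivity_of_notA`, `vernierCoherence_of_notA`, `vernierBracketClearAll_of_notA`, `vernierLower_of_notA`,
`vernierDict_of_notA` (ANY table, ANY constant), `vernierClearDict_of_notA`, `vernierPositivityM_of_notA`,
`vernierBracketClearAllM_of_notA`; (2) the sandwich's other side is the layer's glue (`theorem1_of_vernier…`), and
`notAEventually_of_vernier` records that the glue's hypotheses give back «¬(A) eventually» itself; (3) the junk-table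
instance the desk names (E2/E3): at the zero table the dictionary with a constant `m ≠ 0` is EQUIVALENT to «¬(A) eventually»
(`vernierDict_zeroTable_iff`) — which is why K3's table and constant must be NAMED defs of the design (binding typing
condition of record). References: Zhang, arXiv:2211.02515v1, §2 p. 4 («D sufficiently large»), p. 6 [cite: Zhang2022LandauSiegel, §2 p. 4, p. 6].
-/

noncomputable section

open Complex Real Set

namespace Literature.NumberTheory.LFunctions.Zhang2022.KnifeEdgeEll.Vernier

open Literature.NumberTheory.LFunctions.Zhang2022 Skeleton

/-- «¬(A) eventually» ⇒ Theorem 1 (the manuscript's p. 6 bookkeeping, `Skeleton.theorem1_of_eventually_not_assumptionA`),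
with «¬(A) eventually» spelled `ForAllLarge fun D _ χ => ¬ AssumptionA D χ` throughout this file (no named `Prop` is
introduced for it). [cite: Zhang2022LandauSiegel, §2 p. 6] -/
theorem theorem1_of_notAEventually (h : ForAllLarge fun D _ χ => ¬ AssumptionA D χ) : Theorem1 :=
  Skeleton.theorem1_of_eventually_not_assumptionA h

variable {θ m c' μ : ℝ} {Fam : FamSel} {F : ValueTable} {Φ' : (D : ℕ) → Chr D → ℝ → ℝ}

/-- An (A)-guarded eventual statement follows from «¬(A) eventually». [cite: Zhang2022LandauSiegel, §2 p. 4] -/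
theorem forAllLarge_guarded_of_notA {S : (D : ℕ) → [NeZero D] → DirichletCharacter ℂ D → Prop}
    (h : ForAllLarge fun D _ χ => ¬ AssumptionA D χ) : ForAllLarge fun D _ χ => AssumptionA D χ → S D χ :=
  h.mono fun _ _ _ _ _ hn hA => absurd hA hn

/-- K4 is (A)-guarded: `¬(A)-eventually → VernierPositivity θ c'` (desk (1)). [cite: Zhang2022LandauSiegel, §2 p. 4] -/
theorem vernierPositivity_of_notA (h : ForAllLarge fun D _ χ => ¬ AssumptionA D χ) : VernierPositivity θ c' := forAllLarge_guarded_of_notA h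

/-- K2 is (A)-guarded: `¬(A)-eventually → VernierCoherence θ Φ'` (any `Φ′`; desk (1)). [cite: Zhang2022LandauSiegel, §2 p. 4] -/
theorem vernierCoherence_of_notA (h : ForAllLarge fun D _ χ => ¬ AssumptionA D χ) : VernierCoherence θ Φ' :=
  fun _ _ => forAllLarge_guarded_of_notA h

/-- K2♭ is (A)-guarded: `¬(A)-eventually → VernierBracketClearAll θ`. [cite: Zhang2022LandauSiegel, §2 p. 4] -/
theorem vernierBracketClearAll_of_notA (h : ForAllLarge fun D _ χ => ¬ AssumptionA D χ) : VernierBracketClearAll θ :=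
  forAllLarge_guarded_of_notA h

/-- Assembly (i) is (A)-guarded: `¬(A)-eventually → VernierLower θ c' Fam F`. [cite: Zhang2022LandauSiegel, §2 p. 4] -/
theorem vernierLower_of_notA (h : ForAllLarge fun D _ χ => ¬ AssumptionA D χ) : VernierLower θ c' Fam F :=
  fun _ _ => forAllLarge_guarded_of_notA h

/-- K3's shape is (A)-guarded: `¬(A)-eventually → VernierDict θ c' Fam F m` for ANY table `F` and ANY constant `m`
(desk E1). [cite: Zhang2022LandauSiegel, §2 p. 4] -/
theorem vernierDict_of_notA (h : ForAllLarge fun D _ χ => ¬ AssumptionA D χ) : VernierDict θ c' Fam F m :=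
  fun _ _ => forAllLarge_guarded_of_notA h

/-- The restricted dictionary is (A)-guarded: `¬(A)-eventually → VernierClearDict θ m c' F μ`. [cite: Zhang2022LandauSiegel, §2 p. 4] -/
theorem vernierClearDict_of_notA (h : ForAllLarge fun D _ χ => ¬ AssumptionA D χ) : VernierClearDict θ m c' F μ :=
  fun _ _ => forAllLarge_guarded_of_notA h

/-- K4(m) is (A)-guarded. [cite: Zhang2022LandauSiegel, §2 p. 4] -/
theorem vernierPositivityM_of_notA (h : ForAllLarge fun D _ χ => ¬ AssumptionA D χ) : VernierPositivityM θ m c' := forAllLarge_guarded_of_notA h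

/-- K2♭(m) is (A)-guarded. [cite: Zhang2022LandauSiegel, §2 p. 4] -/
theorem vernierBracketClearAllM_of_notA (h : ForAllLarge fun D _ χ => ¬ AssumptionA D χ) : VernierBracketClearAllM θ m :=
  forAllLarge_guarded_of_notA h

/-- **The sandwich closes on itself:** the glue's hypotheses (Assembly (i) + dictionary with negative constant) give
back «¬(A) eventually» (`eventually_not_assumptionA_of_vernier`), so each (A)-guarded crux C satisfies
`¬(A)-eventually → C` and `(all cruxes) → ¬(A)-eventually` — the desk's «jointly sandwiched between ¬(A)-eventually and
Theorem1». [cite: Zhang2022LandauSiegel, §2 p. 6] -/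
theorem notAEventually_of_vernier (hlow : VernierLower θ c' Fam F) (hdict : VernierDict θ c' Fam F m) (hm : m < 0) :
    ForAllLarge fun D _ χ => ¬ AssumptionA D χ :=
  eventually_not_assumptionA_of_vernier hlow hdict hm

/-- The zero value table (the desk's junk instance E2/E3). [cite: Zhang2022LandauSiegel, §2 (2.16)] -/
def zeroTable : ValueTable := fun _ _ _ _ => 0

/-- The vernier mean of the zero table is `0`. [cite: Zhang2022LandauSiegel, §2 (2.16)] -/
theorem vernierMean_zeroTable {D : ℕ} [NeZero D] (χ : DirichletCharacter ℂ D) :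
    vernierMean θ c' Fam χ (zeroTable D χ) = 0 := by
  simp [vernierMean, zeroTable]

/-- **Desk E3, kernel form: at the zero table a dictionary with constant `m ≠ 0` IS «¬(A) eventually»** — the reason the
route's K3 must pin its value table and constant to NAMED defs of the design (else the crux is the conclusion in
disguise). [cite: Zhang2022LandauSiegel, §2 (2.16), p. 6] -/
theorem vernierDict_zeroTable_iff (hm : m ≠ 0) :
    VernierDict θ c' Fam zeroTable m ↔ ForAllLarge fun D _ χ => ¬ AssumptionA D χ := by
  refine ⟨fun h => ?_, vernierDict_of_notA⟩
  have hε : 0 < |m| / 2 := by positivity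
  obtain ⟨D₁, h₁⟩ := h (|m| / 2) hε
  obtain ⟨a₀, ha₀, D₂, h₂⟩ := frakALowerBound_holds
  obtain ⟨D₃, h₃⟩ := frakP_eventually_pos
  refine ⟨max D₁ (max D₂ D₃), fun D _ χ hD hq hp hA => ?_⟩
  have hD₁ : D₁ ≤ D := le_trans (le_max_left _ _) hD
  have hD₂ : D₂ ≤ D := le_trans (le_trans (le_max_left _ _) (le_max_right _ _)) hD
  have hD₃ : D₃ ≤ D := le_trans (le_trans (le_max_right _ _) (le_max_right _ _)) hD
  have h := h₁ D χ hD₁ hq hp hA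
  rw [vernierMean_zeroTable, zero_sub, abs_neg, abs_mul, abs_mul] at h
  have hA0 : 0 < frakA χ := lt_of_lt_of_le ha₀ (h₂ D χ hD₂ hq hp hA)
  have hP0 : 0 < frakP D := h₃ D hD₃
  rw [abs_of_pos hA0, abs_of_pos hP0] at h
  have hX : 0 < frakA χ * frakP D := mul_pos hA0 hP0
  have hm0 : 0 < |m| := abs_pos.mpr hm
  nlinarith

/-- Desk E2: at the zero table the dictionary crux ALONE (with `m < 0`) closes the leaf — no K4, no K2, no Prop. 2.2.
[cite: Zhang2022LandauSiegel, §2 p. 6] -/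
theorem theorem1_of_vernierDict_zeroTable (h : VernierDict θ c' Fam zeroTable m) (hm : m < 0) : Theorem1 :=
  theorem1_of_notAEventually ((vernierDict_zeroTable_iff hm.ne).mp h)

end Literature.NumberTheory.LFunctions.Zhang2022.KnifeEdgeEll.Vernier

end
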